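import Summits.QuantumFields.QCD.Theorems.QuarksAsStableActionCriticalLineDiamagnetismStaticDiamagEven
import Summits.QuantumFields.QCD.Theorems.QuarksAsStableActionCriticalLineDiamagnetismStaticPressureOdd
import Summits.QuantumFields.QCD.Theorems.QuarksAsStableActionCriticalLineDiamagnetismRectFreqOpStatic
import Summits.QuantumFields.QCD.Theorems.QuarksAsStableActionCriticalLineDiamagnetismPressure

/-!
# Route B helper `staticPressureEven` for stub `stub_heavyFrequencyGain` of line `Sketch` — on an EVEN slice space the
static pressure of any row is at most the free one
(crux `Summit.QuantumFields.QCD.Theses.QuarksAsStableAction.CriticalLineDiamagnetism`, item stmt-QuantumFields-9734,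
static route for odd tori, Route B of the heavy-frequency gain)

For a row of links `r : ℤ/(2k) → U(3)` along the second coordinate of EVEN length `2k`, `m > −1` and a real frequency
pair, let `e_r = ‖det (A_r P⁻ − P⁺)‖` and `M_r` be the `E`-factor and Lüscher's dressed one-step matrix of the row (the
slice data `sliceOpR`, `oneStepR` of the field on `ℤ/1 × ℤ/(2k)` with links `r` along the second coordinate and trivial
links along the first), and `p(M) = Σᵢ log max(μᵢ(M), 1)` the pressure.  Then `log e_r + p(M_r) ≤ log e_1 + p(M_1)`
(`staticPressureEven`, registered) — the even-slice-length companion of `staticPressureOdd`.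

Proof.  For EVERY time length `L₁` the field `S` on `ℤ/L₁ × ℤ/(2k)` with links `r` along the second coordinate on every
row (and trivial links along the first) is dominated by the free field (`staticDiamagEven`: transposition, Lüscher's
transfer form on the even circle and the even-cycle chessboard bound on Fock space); both determinants are in normal
form `‖det D[S]‖ = e^{L₁} · Re det(1 + M^{L₁})` in terms of the one-row slice data (`norm_det_freqOpR_rowStatic`).  The
resulting level inequalities `e_r^{L₁} · Re det(1 + M_r^{L₁}) ≤ e_1^{L₁} · Re det(1 + M_1^{L₁})` at the odd levels
`L₁ = 2n + 1` give the claim by the generic limit lemma `pressure_le_of_levels` (logarithms, division by `L₁`,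
`L₁ → ∞` with the uniform rate of `pressureLimit`; `e > 0` by `norm_det_sliceE_pos`).  Pure theorem file.
-/

noncomputable section

open scoped BigOperators Matrix ComplexConjugate ComplexOrder
open Finset
open Literature.MathematicalPhysics.QuantumLattice Literature.MathematicalPhysics.QuantumFieldTheory
  Literature.Probability.LatticeModels

namespace Summit.QuantumFields.QCD.Cruxes.CriticalLineDiamagnetism.ChessboardCellGain

namespace FrequencyDiamagnetism

open Matrix Complex
open Summit.QuantumFields.QCD.Cruxes.StableActionBridge.Sketch

/-! ### The level-`L₁` comparison on an even slice space -/

/-- The level-`L₁` comparison for an EVEN slice length `2k` and an ARBITRARY time length `L₁`: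
`e_r^{L₁} · Re det(1 + M_r^{L₁}) ≤ e_1^{L₁} · Re det(1 + M_1^{L₁})` (`staticDiamagEven` for the row-static field of time
length `L₁`, both sides in the normal form `norm_det_freqOpR_rowStatic`). -/
theorem rowStaticEven_level_le {L₁ k : ℕ} [NeZero L₁] [NeZero k]
    (r : ZMod (2 * k) → Matrix.unitaryGroup (Fin 3) ℂ) {m : ℝ} (hm : -1 < m) (ω₀ ω₁ : ℝ) :
    ‖(sliceOpR (fun (_ : ZMod 1) (x : ZMod (2 * k)) (μ : Fin 4) => if μ = 3 then r x else 1) m ω₀ ω₁ 0 *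
            projM (2 * k) - projP (2 * k)).det‖ ^ L₁ *
        ((1 + oneStepR (fun (_ : ZMod 1) (x : ZMod (2 * k)) (μ : Fin 4) => if μ = 3 then r x else 1) m ω₀ ω₁ 0 ^
          L₁).det).re ≤
      ‖(sliceOpR (fun (_ : ZMod 1) (_ : ZMod (2 * k)) (_ : Fin 4) => (1 : Matrix.unitaryGroup (Fin 3) ℂ)) m ω₀ ω₁ 0 *
            projM (2 * k) - projP (2 * k)).det‖ ^ L₁ *
        ((1 + oneStepR (fun (_ : ZMod 1) (_ : ZMod (2 * k)) (_ : Fin 4) => (1 : Matrix.unitaryGroup (Fin 3) ℂ)) m ω₀ ω₁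
          0 ^ L₁).det).re := by
  -- adapted from `rowStatic_level_le` (…CriticalLineDiamagnetismStaticPressureOdd.lean)
  rw [← norm_det_freqOpR_rowStatic (fun (_ : ZMod 1) (x : ZMod (2 * k)) (μ : Fin 4) => if μ = 3 then r x else 1)
      (fun (_ : ZMod L₁) (x : ZMod (2 * k)) (μ : Fin 4) => if μ = 3 then r x else 1) (fun _ _ => if_neg (by decide))
      (fun _ _ => rfl) hm ω₀ ω₁,
    ← norm_det_freqOpR_rowStatic
      (fun (_ : ZMod 1) (_ : ZMod (2 * k)) (_ : Fin 4) => (1 : Matrix.unitaryGroup (Fin 3) ℂ))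
      (fun (_ : ZMod L₁) (_ : ZMod (2 * k)) (_ : Fin 4) => (1 : Matrix.unitaryGroup (Fin 3) ℂ)) (fun _ _ => rfl)
      (fun _ _ => rfl) hm ω₀ ω₁]
  exact staticDiamagEven L₁ k r m hm ω₀ ω₁

end FrequencyDiamagnetism

/-! ### The registered helper theorem -/

open FrequencyDiamagnetism in
/-- **Route B helper `staticPressureEven`** (on an EVEN slice space, the static pressure of any row is at most the free
one): for a row of links `r : ℤ/(2k) → U(3)`, `m > −1` and a real frequency pair,
`log e_r + p(M_r) ≤ log e_1 + p(M_1)`, where `e = ‖det (A P⁻ − P⁺)‖` and `M` are the `E`-factor and the (positive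
definite) dressed one-step matrix of the one-row field and `p(M) = Σᵢ log max(μᵢ(M), 1)` — the limit of
`staticDiamagEven` in the normal form `norm_det_freqOpR_rowStatic` along odd time lengths, by `pressure_le_of_levels`
(`pressureLimit`). -/
theorem staticPressureEven : ∀ (k : ℕ) [NeZero k] (r : ZMod (2 * k) → Matrix.unitaryGroup (Fin 3) ℂ) (m : ℝ), -1 < m → ∀ (ω₀ ω₁ : ℝ) (hr : (oneStepR (fun (_ : ZMod 1) (x : ZMod (2 * k)) (μ : Fin 4) => if μ = 3 then r x else 1) m ω₀ ω₁ 0).PosDef) (h1 : (oneStepR (fun (_ : ZMod 1) (_ : ZMod (2 * k)) (_ : Fin 4) => (1 : Matrix.unitaryGroup (Fin 3) ℂ)) m ω₀ ω₁ 0).PosDef), Real.log ‖(sliceOpR (fun (_ : ZMod 1) (x : ZMod (2 * k)) (μ : Fin 4) => if μ = 3 then r x else 1) m ω₀ ω₁ 0 * projM (2 * k) - projP (2 * k)).det‖ + ∑ i, Real.log (max (hr.1.eigenvalues i) 1) ≤ Real.log ‖(sliceOpR (fun (_ : ZMod 1) (_ : ZMod (2 * k)) (_ : Fin 4) => (1 :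 Matrix.unitaryGroup (Fin 3) ℂ)) m ω₀ ω₁ 0 * projM (2 * k) - projP (2 * k)).det‖ + ∑ i, Real.log (max (h1.1.eigenvalues i) 1) := by
  intro k _ r m hm ω₀ ω₁ hr h1
  exact pressure_le_of_levels hr.posSemidef h1.posSemidef (norm_det_sliceE_pos _ hm ω₀ ω₁ 0)
    (norm_det_sliceE_pos _ hm ω₀ ω₁ 0) fun n => rowStaticEven_level_le (L₁ := 2 * n + 1) r hm ω₀ ω₁

end Summit.QuantumFields.QCD.Cruxes.CriticalLineDiamagnetism.ChessboardCellGain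

end
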